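import Literature.NumberTheory.LFunctions.DirichletLOneHalfLogBoundOddSharp
import Literature.NumberTheory.LFunctions.ClassGroupLFunctionExceptionalZeroQuadraticField
import Literature.NumberTheory.QuadraticFields.KroneckerCharacterEvenDiscriminant
import Literature.NumberTheory.QuadraticFields.QuadraticDedekindZetaKronecker
import Literature.NumberTheory.QuadraticFields.ImaginaryResiduePiForm
import Literature.NumberTheory.QuadraticFields.QuadraticDedekindZetaZeros
import Literature.NumberTheory.LFunctions.ZetaRealAxis
import Literature.NumberTheory.LFunctions.RealZeroLOneLowerBoundExplicit
import Mathlib.NumberTheory.NumberField.ClassNumber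
import HarnessLib

/-!
# `h_K ≤ π⁻¹ √|d_K| (½ log|d_K| + 1.3)` for imaginary quadratic fields, unconditionally (proved)

Topic `Literature/NumberTheory/LFunctions`, namespace `Literature.NumberTheory.LFunctions.Louboutin2001`
(companion of `DedekindZetaResidueRealQuadraticBound` — the real-quadratic reading of the even bound — and of
`DirichletLOneHalfLogBoundOdd`, whose kernel theorem `norm_LFunction_one_le_of_odd`
(`|L(1, χ)| ≤ ½ log q + 1.3` for odd primitive `χ`) is read here through the analytic class number formula).
Everything is PROVED; no definitions, no named facts. Typed by the literature-typing seat `littype-FP2-1`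
(cell `parity-realchar`, D-0088 (4) row (7), statement layer / provenance).

Second theorem (appended): the EXCEPTIONAL-ZERO form — if the continued Dedekind zeta function of the
imaginary quadratic field `K` (`d_K < −4`) vanishes at a real `β ∈ (0, 1)`, then
`h_K ≤ (1 − β) · π⁻¹ √|d_K| (log|d_K| + ½)²/8` (`classNumber_le_of_dedekindZetaCont_eq_zero`): the Kronecker
character `κ` is odd, primitive, quadratic, `ζ_K(β) = ζ(β) L(β, κ)` (`Quadratic.dedekindZetaCont_eq_riemannZeta_mul_LFunction`)
with `ζ(β) < 0` (`riemannZeta_neg_of_pos_of_lt_one`), so `L(β, κ) = 0` and the tree's kernel form of Louboutin 2006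
Theorem 1 (ii), odd case (`norm_LFunction_one_le_of_zero_of_odd`: `L(1, κ) ≤ (1 − β)(log q + ½)²/8`) applies.

Third group (appended): the CONDITIONALS I.1 kernel line, UPPER half, v4 — in the shape of
`RealZeroLOneLowerBoundExplicit` (odd `d_K`, the Jacobi character `χ_{d_K}` mod `q = |d_K|`):
`classNumber_le_of_realZero_explicit_v4` — a real zero `0 < β < 1` of `L(s, χ_{d_K})` gives
`h_K ≤ (1/(8π)) √q (log q + ½)² (1 − β)` for every odd `d_K < −4` (v3 had `(1/π) √q log² q (1 − β)` for
`β ≥ 1 − 1/(40 log q)`, `q ≥ 10⁴`); `classNumber_two_sided_of_realZero_explicit_v4` — with the kernel lower half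
`classNumber_ge_of_realZero_explicit_v3` (`0.81/π`): for `q ≥ 10⁴`, `β ≥ 1 − 1/(10 log q)`,
`(0.81/π) √q (1 − β) ≤ h_K ≤ (1/(8π)) √q (log q + ½)² (1 − β)` (print comparator: BGTZ 2025 Lemma 2.9 via
`classNumber_bounds_of_landauSiegelZero`, `0.36/π · w_K` and `0.09/π · w_K log² q`, `q > 4·10⁵`, modulo the
named fact `BGTZ2025.lemma29`).

What the tree had: `Quadratic.classNumber_le_sqrt_mul_log` (`h_K ≤ π⁻¹ √|d_K| log|d_K|`, Oesterlé (27), proved)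
and `Ramare2001.classNumber_le` (`h_K ≤ π⁻¹ √|d_K| (½ log|d_K| + 5/2 − log 6)` MODULO the named fact
`ramare2001_corollary1`). This file: the half-log main term with NO hypothesis, constant `1.3`
(`classNumber_le_of_discr_lt_neg_four`), and — appended 2026-08-29 from the sequel
`DirichletLOneHalfLogBoundOddSharp` (Louboutin's PRINTED odd constant `κ₁ = 2 + γ − log π`) —
`classNumber_le_of_discr_lt_neg_four_sharp`: `h_K ≤ π⁻¹ √|d_K| (½ log|d_K| + κ₁/2)`, decimal `_d4`: `½ log|d_K| + 0.7163`.

Fourth group (appended 2026-08-29, from the sequel's `norm_LFunction_one_le_of_zero_of_odd_sharp` =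
Louboutin 2006 Theorem 1 (ii) (3), odd quadratic case, AS PRINTED: `|L(1, χ)| ≤ (1 − β) log² q/8`): the
exceptional-zero class-number bounds with the PRINTED `log²|d_K|` in place of `(log|d_K| + ½)²` —
`classNumber_le_of_dedekindZetaCont_eq_zero_sharp` (`h_K ≤ (1 − β) π⁻¹ √|d_K| log²|d_K|/8`, every imaginary
quadratic `K` with `d_K < −4`, `ζ_K(β) = 0`, `0 < β < 1`), `classNumber_le_of_realZero_explicit_v5`
(`h_K ≤ (1/(8π)) √q log² q (1 − β)`, odd `d_K < −4`, real zero of `L(s, χ_{d_K})`) and the two-sided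
`classNumber_two_sided_of_realZero_explicit_v5` (`(0.81/π) √q (1 − β) ≤ h_K ≤ (1/(8π)) √q log² q (1 − β)`,
`q ≥ 10⁴`, `β ≥ 1 − 1/(10 log q)`); the v4 statements stay for their consumers.

## Sources, as printed

* S. Louboutin, Acta Arith. 121 (2006) 199–220 [Louboutin2006RelativeClassNumbers], **Theorem 1 (2)** p. 200:
  «`|L(1, χ)| ≤ ½(log f + κ_χ)`, `κ_χ = κ₁ = 2 + γ − log π = 1.432485…` if `χ` is odd» — used through the
  tree's weaker-constant kernel form `norm_LFunction_one_le_of_odd` (`½ log q + 1.3`).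
* J. Neukirch, *Algebraic Number Theory*, Ch. VII §5 (5.11) [NeukirchANT1999]: the analytic class number
  formula, in the tree as `Quadratic.LFunction_one_eq_of_discr_neg_of_eq` (`L(1, κ) = 2π h_K/(w_K √|d_K|)`)
  with `w_K = 2` for `d_K < −4` (`Quadratic.torsionOrder_eq_two_of_discr_lt_neg_four`).

Ingredients (tree): the ODD primitive Kronecker character of an imaginary quadratic field — odd `d_K`: the
Jacobi character mod `|d_K| ≡ 3 (mod 4)` (`Quadratic.dedekindZeta_eq_riemannZeta_mul_LSeries`,
`isPrimitive_jacobiChar`, `jacobiSym.at_neg_one`, `ZMod.χ₄_nat_three_mod_four`); even `d_K`: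
`Quadratic.exists_kroneckerChar_of_four_dvd` (parity included).

## References
* [Louboutin2006RelativeClassNumbers] S. Louboutin, Acta Arith. 121 (2006) 199–220, doi 10.4064/aa121-3-1.
* [NeukirchANT1999] J. Neukirch, *Algebraic Number Theory*, Springer 1999, Ch. VII §5.
-/

noncomputable section

open Complex Real
open scoped ComplexOrder

namespace Literature.NumberTheory.LFunctions

namespace Louboutin2001

open DirichletCharacter Literature.NumberTheory.QuadraticFields
  Literature.NumberTheory.QuadraticFields.Quadratic

variable {K : Type*} [Field K] [NumberField K]

/-- The Kronecker character of an IMAGINARY quadratic field is an odd primitive character `κ ≠ 1` mod `|d_K|`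
with `ζ_K(s) = ζ(s) L(s, κ)` (`Re s > 1`) — odd `d_K ≡ 1 (mod 4)`, `d_K < 0`: the Jacobi character mod
`|d_K| ≡ 3 (mod 4)`, `(−1/|d_K|) = χ₄(|d_K|) = −1`; even `d_K`: the tree's Kronecker character mod `4|m|`. [folklore] -/
private theorem exists_odd_kroneckerChar (h2 : Module.finrank ℚ K = 2) (hd : NumberField.discr K < 0) :
    ∃ (M : ℕ) (_ : NeZero M) (κ : DirichletCharacter ℂ M), M = (NumberField.discr K).natAbs ∧ κ ≠ 1 ∧
      κ.IsPrimitive ∧ κ.Odd ∧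
      ∀ s : ℂ, 1 < s.re → NumberField.dedekindZeta K s = riemannZeta s * LSeries (fun n ↦ κ n) s := by
  rcases isFundamentalDiscriminant_discr (K := K) h2 with ⟨h1, hsqf, -⟩ | ⟨h4, -, -⟩
  · -- odd discriminant `d ≡ 1 (mod 4)`, `d < 0`, so `|d| ≡ 3 (mod 4)`
    have hodd : Odd (NumberField.discr K) := by rw [Int.odd_iff]; omega
    haveI := neZero_natAbs_discr (K := K)
    have hoddN : Odd (NumberField.discr K).natAbs := Int.natAbs_odd.mpr hodd
    have hsqN : Squarefree (NumberField.discr K).natAbs := Int.squarefree_natAbs.mpr hsqf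
    have hmod : (NumberField.discr K).natAbs % 4 = 3 := by
      have : ((NumberField.discr K).natAbs : ℤ) = -NumberField.discr K :=
        Int.ofNat_natAbs_of_nonpos hd.le
      omega
    have hoddκ : (jacobiChar (NumberField.discr K).natAbs).Odd := by
      show jacobiChar (NumberField.discr K).natAbs (-1) = -1
      have h := jacobiChar_intCast (q := (NumberField.discr K).natAbs) (-1)
      rw [Int.cast_neg, Int.cast_one] at h
      rw [h, jacobiSym.at_neg_one hoddN, ZMod.χ₄_nat_three_mod_four hmod, Int.cast_neg, Int.cast_one]
    exact ⟨(NumberField.discr K).natAbs, inferInstance, jacobiChar (NumberField.discr K).natAbs, rfl,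
      jacobiChar_natAbs_discr_ne_one h2 hodd, isPrimitive_jacobiChar hoddN hsqN, hoddκ,
      fun s hs ↦ dedekindZeta_eq_riemannZeta_mul_LSeries h2 hodd hs⟩
  · -- even discriminant
    haveI := neZero_natAbs_discr (K := K)
    obtain ⟨κ, hprim, -, hne, -, -, hod, hfac⟩ := exists_kroneckerChar_of_four_dvd h2 h4
    exact ⟨(NumberField.discr K).natAbs, inferInstance, κ, rfl, hne, hprim, hod hd, hfac⟩

/-- **Class-number form of the odd-character bound, imaginary quadratic fields**: for `K` with `[K : ℚ] = 2`
and `d_K < −4`, **`h_K ≤ π⁻¹ √|d_K| (½ log|d_K| + 1.3)`** — unconditionally (kernel), halving the main term of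
the tree's `Quadratic.classNumber_le_sqrt_mul_log` (`π⁻¹ √|d_K| log|d_K|`, Oesterlé) and removing the named
fact `ramare2001_corollary1` from `Ramare2001.classNumber_le` at the price of the constant (`1.3` for
`5/2 − log 6 = 0.708…`). Proof: the odd primitive Kronecker character `κ ≠ 1` mod `|d_K|` with `ζ_K = ζ·L(κ)`,
the class number formula `L(1, κ) = 2π h_K/(w_K √|d_K|)` with `w_K = 2`
(`Quadratic.LFunction_one_eq_of_discr_neg_of_eq`), and `norm_LFunction_one_le_of_odd`
(Louboutin's (2), odd case, with the elementary constant). [cite: Louboutin2006RelativeClassNumbers, Thm 1 (2) p. 200]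
[cite: NeukirchANT1999, Ch. VII §5 (5.11)] -/
theorem classNumber_le_of_discr_lt_neg_four (h2 : Module.finrank ℚ K = 2) (hd : NumberField.discr K < -4) :
    (NumberField.classNumber K : ℝ) ≤
      Real.pi⁻¹ * Real.sqrt ((NumberField.discr K).natAbs : ℝ) *
        (Real.log ((NumberField.discr K).natAbs : ℝ) / 2 + 1.3) := by
  classical
  have hneg : NumberField.discr K < 0 := by omega
  obtain ⟨M, _, κ, hM, hκ, hprim, hodd, hfac⟩ := exists_odd_kroneckerChar h2 hneg
  have hcnf := LFunction_one_eq_of_discr_neg_of_eq h2 hneg hκ (fun s hs ↦ hfac s (by simpa using hs))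
  have hw : (NumberField.Units.torsionOrder K : ℝ) = 2 := by
    exact_mod_cast torsionOrder_eq_two_of_discr_lt_neg_four h2 hd
  have habs : |(NumberField.discr K : ℝ)| = (M : ℝ) := by
    rw [← Int.cast_abs, Int.abs_eq_natAbs, Int.cast_natCast, hM]
  have hM4 : (4 : ℝ) < M := by
    rw [← habs]
    have : (NumberField.discr K : ℝ) < -4 := by exact_mod_cast hd
    rw [abs_of_neg (by linarith)]
    linarith
  have hB := norm_LFunction_one_le_of_odd hprim hodd
  rw [hcnf, Complex.norm_real, Real.norm_eq_abs, hw, habs, abs_of_nonneg (by positivity)] at hB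
  have hsq : 0 < Real.sqrt (M : ℝ) := Real.sqrt_pos.2 (by linarith)
  have hπ := Real.pi_pos
  rw [div_le_iff₀ (by positivity)] at hB
  rw [← hM]
  calc (NumberField.classNumber K : ℝ)
      = Real.pi⁻¹ * (2 * Real.pi * NumberField.classNumber K) / 2 := by field_simp
    _ ≤ Real.pi⁻¹ * ((Real.log M / 2 + 1.3) * (2 * Real.sqrt M)) / 2 := by gcongr
    _ = Real.pi⁻¹ * Real.sqrt M * (Real.log M / 2 + 1.3) := by ring

/-- The same bound against the real absolute value `|d_K|`: `h_K ≤ π⁻¹ √|d_K| (½ log|d_K| + 1.3)`.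
[cite: Louboutin2006RelativeClassNumbers, Thm 1 (2) p. 200] [cite: NeukirchANT1999, Ch. VII §5 (5.11)] -/
theorem classNumber_le_of_discr_lt_neg_four' (h2 : Module.finrank ℚ K = 2) (hd : NumberField.discr K < -4) :
    (NumberField.classNumber K : ℝ) ≤
      Real.pi⁻¹ * Real.sqrt |(NumberField.discr K : ℝ)| * (Real.log |(NumberField.discr K : ℝ)| / 2 + 1.3) := by
  have h := classNumber_le_of_discr_lt_neg_four h2 hd
  have habs : |(NumberField.discr K : ℝ)| = ((NumberField.discr K).natAbs : ℝ) := by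
    rw [← Int.cast_abs, Int.abs_eq_natAbs, Int.cast_natCast]
  rwa [habs]

/-- The Kronecker character of an imaginary quadratic field, with quadraticity recorded. [folklore] -/
private theorem exists_odd_quadratic_kroneckerChar (h2 : Module.finrank ℚ K = 2) (hd : NumberField.discr K < 0) :
    ∃ (M : ℕ) (_ : NeZero M) (κ : DirichletCharacter ℂ M), M = (NumberField.discr K).natAbs ∧ κ ≠ 1 ∧
      κ.IsPrimitive ∧ κ.Odd ∧ κ.IsQuadratic ∧
      ∀ s : ℂ, 1 < s.re → NumberField.dedekindZeta K s = riemannZeta s * LSeries (fun n ↦ κ n) s := by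
  rcases isFundamentalDiscriminant_discr (K := K) h2 with ⟨h1, hsqf, -⟩ | ⟨h4, -, -⟩
  · have hodd : Odd (NumberField.discr K) := by rw [Int.odd_iff]; omega
    haveI := neZero_natAbs_discr (K := K)
    have hoddN : Odd (NumberField.discr K).natAbs := Int.natAbs_odd.mpr hodd
    have hsqN : Squarefree (NumberField.discr K).natAbs := Int.squarefree_natAbs.mpr hsqf
    have hmod : (NumberField.discr K).natAbs % 4 = 3 := by
      have : ((NumberField.discr K).natAbs : ℤ) = -NumberField.discr K :=
        Int.ofNat_natAbs_of_nonpos hd.le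
      omega
    have hoddκ : (jacobiChar (NumberField.discr K).natAbs).Odd := by
      show jacobiChar (NumberField.discr K).natAbs (-1) = -1
      have h := jacobiChar_intCast (q := (NumberField.discr K).natAbs) (-1)
      rw [Int.cast_neg, Int.cast_one] at h
      rw [h, jacobiSym.at_neg_one hoddN, ZMod.χ₄_nat_three_mod_four hmod, Int.cast_neg, Int.cast_one]
    exact ⟨(NumberField.discr K).natAbs, inferInstance, jacobiChar (NumberField.discr K).natAbs, rfl,
      jacobiChar_natAbs_discr_ne_one h2 hodd, isPrimitive_jacobiChar hoddN hsqN, hoddκ,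
      fun a ↦ jacobiChar_trichotomy a,
      fun s hs ↦ dedekindZeta_eq_riemannZeta_mul_LSeries h2 hodd hs⟩
  · haveI := neZero_natAbs_discr (K := K)
    obtain ⟨κ, hprim, hquad, hne, -, -, hod, hfac⟩ := exists_kroneckerChar_of_four_dvd h2 h4
    exact ⟨(NumberField.discr K).natAbs, inferInstance, κ, rfl, hne, hprim, hod hd, hquad, hfac⟩

/-- **Exceptional zero ⇒ small class number, imaginary quadratic fields, explicitly**: for `K` with
`[K : ℚ] = 2`, `d_K < −4`, if `ζ_K(β) = 0` (the continued Dedekind zeta function `dedekindZetaCont K`) for a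
real `0 < β < 1`, then **`h_K ≤ (1 − β) · π⁻¹ √|d_K| (log|d_K| + ½)²/8`** — Louboutin 2006 Theorem 1 (ii), odd
case (`0 < L(1, χ) ≤ (1 − β) log² f/8`; here through the tree's kernel form with `(log q + ½)²`,
`norm_LFunction_one_le_of_zero_of_odd`) read through `ζ_K = ζ · L(·, κ)` off `s = 1`, `ζ(β) < 0` on `(0, 1)`,
and the class number formula `L(1, κ) = π h_K/√|d_K|` (`w_K = 2`). Contrapositive: a class number
`h_K > (1 − β) π⁻¹ √|d_K| (log|d_K| + ½)²/8` EXCLUDES a zero of `ζ_K` at `β` (e.g. from class-number tables).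
[cite: Louboutin2006RelativeClassNumbers, Thm 1 (3) p. 200] [cite: NeukirchANT1999, Ch. VII §5 (5.11)] -/
theorem classNumber_le_of_dedekindZetaCont_eq_zero (h2 : Module.finrank ℚ K = 2)
    (hd : NumberField.discr K < -4) {β : ℝ} (hβ0 : 0 < β) (hβ1 : β < 1)
    (hz : dedekindZetaCont K β = 0) :
    (NumberField.classNumber K : ℝ) ≤
      (1 - β) * (Real.pi⁻¹ * Real.sqrt ((NumberField.discr K).natAbs : ℝ) *
        (Real.log ((NumberField.discr K).natAbs : ℝ) + 1 / 2) ^ 2 / 8) := by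
  classical
  have hneg : NumberField.discr K < 0 := by omega
  obtain ⟨M, _, κ, hM, hκ, hprim, hodd, hquad, hfac⟩ := exists_odd_quadratic_kroneckerChar h2 hneg
  -- `ζ_K(β) = ζ(β) L(β, κ)` and `ζ(β) ≠ 0`
  have hβne : (β : ℂ) ≠ 1 := by
    intro h
    have := congrArg Complex.re h
    simp at this
    linarith
  have hfacβ := dedekindZetaCont_eq_riemannZeta_mul_LFunction (K := K) hκ hfac hβne
  rw [hz] at hfacβ
  have hζ : riemannZeta β ≠ 0 := (riemannZeta_neg_of_pos_of_lt_one hβ0 hβ1).ne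
  have hLβ : κ.LFunction β = 0 := by
    rcases mul_eq_zero.mp hfacβ.symm with h | h
    · exact absurd h hζ
    · exact h
  have hB := norm_LFunction_one_le_of_zero_of_odd hprim hodd hquad hβ0 hβ1 hLβ
  -- class number formula
  have hcnf := LFunction_one_eq_of_discr_neg_of_eq h2 hneg hκ (fun s hs ↦ hfac s (by simpa using hs))
  have hw : (NumberField.Units.torsionOrder K : ℝ) = 2 := by
    exact_mod_cast torsionOrder_eq_two_of_discr_lt_neg_four h2 hd
  have habs : |(NumberField.discr K : ℝ)| = (M : ℝ) := by
    rw [← Int.cast_abs, Int.abs_eq_natAbs, Int.cast_natCast, hM]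
  have hM4 : (4 : ℝ) < M := by
    rw [← habs]
    have : (NumberField.discr K : ℝ) < -4 := by exact_mod_cast hd
    rw [abs_of_neg (by linarith)]
    linarith
  rw [hcnf, Complex.norm_real, Real.norm_eq_abs, hw, habs, abs_of_nonneg (by positivity)] at hB
  have hsq : 0 < Real.sqrt (M : ℝ) := Real.sqrt_pos.2 (by linarith)
  have hπ := Real.pi_pos
  rw [div_le_iff₀ (by positivity)] at hB
  rw [← hM]
  set B : ℝ := (1 - β) * (Real.log M + 1 / 2) ^ 2 / 8 with hBdef
  have hB' : 2 * Real.pi * NumberField.classNumber K ≤ B * (2 * Real.sqrt M) := hB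
  calc (NumberField.classNumber K : ℝ)
      = Real.pi⁻¹ * (2 * Real.pi * NumberField.classNumber K) / 2 := by field_simp
    _ ≤ Real.pi⁻¹ * (B * (2 * Real.sqrt M)) / 2 := by gcongr
    _ = (1 - β) * (Real.pi⁻¹ * Real.sqrt M * (Real.log M + 1 / 2) ^ 2 / 8) := by rw [hBdef]; ring

/-- The Jacobi character mod `|d_K|` of an imaginary quadratic field with odd discriminant is primitive and
odd (`|d_K| ≡ 3 (mod 4)`, `χ₄(|d_K|) = −1`). [folklore] -/
private theorem jacobiChar_primitive_odd (h2 : Module.finrank ℚ K = 2) (hodd : Odd (NumberField.discr K))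
    (hd : NumberField.discr K < 0) :
    (jacobiChar (NumberField.discr K).natAbs).IsPrimitive ∧ (jacobiChar (NumberField.discr K).natAbs).Odd := by
  rcases isFundamentalDiscriminant_discr (K := K) h2 with ⟨h1, hsqf, -⟩ | ⟨h4, -, -⟩
  · have hoddN : Odd (NumberField.discr K).natAbs := Int.natAbs_odd.mpr hodd
    have hsqN : Squarefree (NumberField.discr K).natAbs := Int.squarefree_natAbs.mpr hsqf
    have hmod : (NumberField.discr K).natAbs % 4 = 3 := by
      have : ((NumberField.discr K).natAbs : ℤ) = -NumberField.discr K :=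
        Int.ofNat_natAbs_of_nonpos hd.le
      omega
    refine ⟨isPrimitive_jacobiChar hoddN hsqN, ?_⟩
    show jacobiChar (NumberField.discr K).natAbs (-1) = -1
    have h := jacobiChar_intCast (q := (NumberField.discr K).natAbs) (-1)
    rw [Int.cast_neg, Int.cast_one] at h
    rw [h, jacobiSym.at_neg_one hoddN, ZMod.χ₄_nat_three_mod_four hmod, Int.cast_neg, Int.cast_one]
  · exfalso
    obtain ⟨k, hk⟩ := hodd
    omega

/-- **I.1 kernel line, UPPER half, v4**: for an imaginary quadratic field `K` with odd `d_K < −4`,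
`q = |d_K|`, and a real zero `0 < β < 1` of `L(s, χ_{d_K})` (`χ_{d_K}` = the Jacobi character mod `q`):
**`h_K ≤ (1/(8π)) √q (log q + ½)² (1 − β)`** — Louboutin 2006 Theorem 1 (ii), odd case (kernel form
`norm_LFunction_one_le_of_zero_of_odd`, constant `(log q + ½)²` for the printed `log² q`) through the class number
formula `L(1, χ_{d_K}) = 2π h_K/(w_K √q)`, `w_K = 2`. (v3: `(1/π) √q log² q (1 − β)` for `β ≥ 1 − 1/(40 log q)`,
`q ≥ 10⁴`, `RealZeroLOneLowerBoundExplicit`.) [cite: Louboutin2006RelativeClassNumbers, Thm 1 (3) p. 200]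
[cite: NeukirchANT1999, Ch. VII §5 (5.11)] -/
theorem classNumber_le_of_realZero_explicit_v4 (h2 : Module.finrank ℚ K = 2)
    (hodd : Odd (NumberField.discr K)) (hd : NumberField.discr K < -4) {β : ℝ} (hβ0 : 0 < β) (hβ1 : β < 1)
    (hz : (jacobiChar (NumberField.discr K).natAbs).LFunction β = 0) :
    (NumberField.classNumber K : ℝ) ≤
      1 / (8 * Real.pi) * Real.sqrt (NumberField.discr K).natAbs *
        (Real.log (NumberField.discr K).natAbs + 1 / 2) ^ 2 * (1 - β) := by
  have hneg : NumberField.discr K < 0 := by omega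
  haveI : NeZero (NumberField.discr K).natAbs := ⟨by omega⟩
  obtain ⟨hprim, hoddχ⟩ := jacobiChar_primitive_odd h2 hodd hneg
  have hB := norm_LFunction_one_le_of_zero_of_odd hprim hoddχ isQuadratic_jacobiChar hβ0 hβ1 hz
  have hcnf := LFunction_jacobiChar_one_eq_of_discr_neg h2 hodd hneg
  have habs : |(NumberField.discr K : ℝ)| = ((NumberField.discr K).natAbs : ℝ) := by
    rw [← Int.cast_abs, Int.abs_eq_natAbs, Int.cast_natCast]
  have hw : (NumberField.Units.torsionOrder K : ℝ) = 2 := by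
    exact_mod_cast torsionOrder_eq_two_of_discr_lt_neg_four h2 hd
  have hq4 : (4 : ℝ) < (NumberField.discr K).natAbs := by
    have : (4 : ℤ) < ((NumberField.discr K).natAbs : ℤ) := by omega
    exact_mod_cast this
  rw [hcnf, habs, hw, Complex.norm_real, Real.norm_eq_abs, abs_of_nonneg (by positivity)] at hB
  have hsq : 0 < Real.sqrt ((NumberField.discr K).natAbs : ℝ) := Real.sqrt_pos.2 (by linarith)
  have hπ := Real.pi_pos
  rw [div_le_iff₀ (by positivity)] at hB
  set M : ℕ := (NumberField.discr K).natAbs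
  set B : ℝ := (1 - β) * (Real.log M + 1 / 2) ^ 2 / 8 with hBdef
  have hB' : 2 * Real.pi * NumberField.classNumber K ≤ B * (2 * Real.sqrt M) := hB
  calc (NumberField.classNumber K : ℝ)
      = Real.pi⁻¹ * (2 * Real.pi * NumberField.classNumber K) / 2 := by field_simp
    _ ≤ Real.pi⁻¹ * (B * (2 * Real.sqrt M)) / 2 := by gcongr
    _ = 1 / (8 * Real.pi) * Real.sqrt M * (Real.log M + 1 / 2) ^ 2 * (1 - β) := by rw [hBdef]; field_simp

/-- **I.1 kernel line, two-sided, v4**: for an imaginary quadratic `K`, odd `d_K`, `q = |d_K| ≥ 10⁴`, and a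
real zero `β ≥ 1 − 1/(10 log q)` of `L(s, χ_{d_K})`:
**`(0.81/π) √q (1 − β) ≤ h_K ≤ (1/(8π)) √q (log q + ½)² (1 − β)`** (lower half: the tree's
`classNumber_ge_of_realZero_explicit_v3`; upper half: v4 above). Print comparator: Benli–Goel–Twiss–Zaman 2025
Lemma 2.9 read through the class number formula (`classNumber_bounds_of_landauSiegelZero`: `0.36/π · w_K √q (1−β₁)
≤ h_K ≤ 0.09/π · w_K √q log² q (1−β₁)`, `q > 4·10⁵`, MODULO the named fact `BGTZ2025.lemma29`).
[cite: BenliGoelTwissZaman2025, Lemma 2.9] [cite: Louboutin2006RelativeClassNumbers, Thm 1 (3) p. 200] -/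
theorem classNumber_two_sided_of_realZero_explicit_v4 (h2 : Module.finrank ℚ K = 2)
    (hodd : Odd (NumberField.discr K)) (hd : NumberField.discr K < 0)
    (hq : 10 ^ 4 ≤ (NumberField.discr K).natAbs) {β : ℝ}
    (hβ : 1 - 1 / (10 * Real.log (NumberField.discr K).natAbs) ≤ β)
    (hz : (jacobiChar (NumberField.discr K).natAbs).LFunction β = 0) :
    0.81 / Real.pi * Real.sqrt (NumberField.discr K).natAbs * (1 - β) ≤ (NumberField.classNumber K : ℝ) ∧
      (NumberField.classNumber K : ℝ) ≤
        1 / (8 * Real.pi) * Real.sqrt (NumberField.discr K).natAbs *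
          (Real.log (NumberField.discr K).natAbs + 1 / 2) ^ 2 * (1 - β) := by
  haveI : NeZero (NumberField.discr K).natAbs := ⟨by omega⟩
  have hd4 : NumberField.discr K < -4 := by
    have : (10 ^ 4 : ℤ) ≤ ((NumberField.discr K).natAbs : ℤ) := by exact_mod_cast hq
    omega
  have hne : jacobiChar (NumberField.discr K).natAbs ≠ 1 := jacobiChar_natAbs_discr_ne_one h2 hodd
  have hβ1 : β < 1 := RealZeroRepulsion.realZero_lt_one _ hne hz
  have hq' : (10 ^ 4 : ℝ) ≤ (NumberField.discr K).natAbs := by exact_mod_cast hq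
  have hlog : 9 ≤ Real.log (NumberField.discr K).natAbs := by
    rw [Real.le_log_iff_exp_le (by linarith)]
    have h3 : Real.exp 9 = Real.exp 1 ^ 9 := by rw [← Real.exp_nat_mul]; norm_num
    have he : Real.exp 1 < 2.7182818286 := Real.exp_one_lt_d9
    have h9 : Real.exp 1 ^ 9 < (2.7182818286 : ℝ) ^ 9 :=
      pow_lt_pow_left₀ he (Real.exp_pos 1).le (by norm_num)
    rw [h3]; nlinarith
  have hβ0 : 0 < β := by
    have : 1 / (10 * Real.log (NumberField.discr K).natAbs) ≤ 1 / 90 := by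
      apply one_div_le_one_div_of_le (by norm_num); linarith
    linarith
  exact ⟨classNumber_ge_of_realZero_explicit_v3 h2 hodd hd hq hβ hz,
    classNumber_le_of_realZero_explicit_v4 h2 hodd hd4 hβ0 hβ1 hz⟩

/-! ### The same with Louboutin's printed constant `κ₁ = 2 + γ − log π` (sequel `DirichletLOneHalfLogBoundOddSharp`) -/

/-- **Class-number form of Louboutin's Theorem 1 (2), odd case, with the PRINTED constant**: for `K` with
`[K : ℚ] = 2` and `d_K < −4`, **`h_K ≤ π⁻¹ √|d_K| (½ log|d_K| + κ₁/2)`**, `κ₁ = 2 + γ − log π = 1.4325…`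
(equivalently `h_K ≤ (√|d_K|/2π)(log|d_K| + κ₁)`), sharpening `classNumber_le_of_discr_lt_neg_four` (`1.3`) by the
sequel's `norm_LFunction_one_le_of_odd_sharp`; same proof (odd primitive Kronecker character, class number formula
with `w_K = 2`). [cite: Louboutin2006RelativeClassNumbers, Thm 1 (2) p. 200] [cite: NeukirchANT1999, Ch. VII §5 (5.11)] -/
theorem classNumber_le_of_discr_lt_neg_four_sharp (h2 : Module.finrank ℚ K = 2)
    (hd : NumberField.discr K < -4) :
    (NumberField.classNumber K : ℝ) ≤
      Real.pi⁻¹ * Real.sqrt ((NumberField.discr K).natAbs : ℝ) *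
        (Real.log ((NumberField.discr K).natAbs : ℝ) / 2 +
          (2 + Real.eulerMascheroniConstant - Real.log Real.pi) / 2) := by
  classical
  have hneg : NumberField.discr K < 0 := by omega
  obtain ⟨M, _, κ, hM, hκ, hprim, hodd, hfac⟩ := exists_odd_kroneckerChar h2 hneg
  have hcnf := LFunction_one_eq_of_discr_neg_of_eq h2 hneg hκ (fun s hs ↦ hfac s (by simpa using hs))
  have hw : (NumberField.Units.torsionOrder K : ℝ) = 2 := by
    exact_mod_cast torsionOrder_eq_two_of_discr_lt_neg_four h2 hd
  have habs : |(NumberField.discr K : ℝ)| = (M : ℝ) := by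
    rw [← Int.cast_abs, Int.abs_eq_natAbs, Int.cast_natCast, hM]
  have hM4 : (4 : ℝ) < M := by
    rw [← habs]
    have : (NumberField.discr K : ℝ) < -4 := by exact_mod_cast hd
    rw [abs_of_neg (by linarith)]
    linarith
  have hB := norm_LFunction_one_le_of_odd_sharp hprim hodd
  rw [hcnf, Complex.norm_real, Real.norm_eq_abs, hw, habs, abs_of_nonneg (by positivity)] at hB
  have hsq : 0 < Real.sqrt (M : ℝ) := Real.sqrt_pos.2 (by linarith)
  have hπ := Real.pi_pos
  rw [div_le_iff₀ (by positivity)] at hB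
  rw [← hM]
  calc (NumberField.classNumber K : ℝ)
      = Real.pi⁻¹ * (2 * Real.pi * NumberField.classNumber K) / 2 := by field_simp
    _ ≤ Real.pi⁻¹ * ((Real.log M / 2 + (2 + Real.eulerMascheroniConstant - Real.log Real.pi) / 2) *
        (2 * Real.sqrt M)) / 2 := by gcongr
    _ = Real.pi⁻¹ * Real.sqrt M *
        (Real.log M / 2 + (2 + Real.eulerMascheroniConstant - Real.log Real.pi) / 2) := by ring

/-- Decimal form: **`h_K ≤ π⁻¹ √|d_K| (½ log|d_K| + 0.7163)`** for every imaginary quadratic `K` with `d_K < −4`.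
[cite: Louboutin2006RelativeClassNumbers, Thm 1 (2) p. 200 and (1)] [cite: NeukirchANT1999, Ch. VII §5 (5.11)] -/
theorem classNumber_le_of_discr_lt_neg_four_d4 (h2 : Module.finrank ℚ K = 2)
    (hd : NumberField.discr K < -4) :
    (NumberField.classNumber K : ℝ) ≤
      Real.pi⁻¹ * Real.sqrt ((NumberField.discr K).natAbs : ℝ) *
        (Real.log ((NumberField.discr K).natAbs : ℝ) / 2 + 0.7163) := by
  have h := classNumber_le_of_discr_lt_neg_four_sharp h2 hd
  have hk := kappaOdd_div_two_lt
  unfold kappaOdd at hk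
  have h0 : 0 ≤ Real.pi⁻¹ * Real.sqrt ((NumberField.discr K).natAbs : ℝ) := by positivity
  calc (NumberField.classNumber K : ℝ) ≤ _ := h
    _ ≤ _ := by
        refine mul_le_mul_of_nonneg_left ?_ h0
        norm_num at hk ⊢
        linarith

/-! ### Exceptional-zero forms with the PRINTED `log²` (sequel `DirichletLOneHalfLogBoundOddSharp`,
`norm_LFunction_one_le_of_zero_of_odd_sharp`) -/

/-- **Exceptional zero ⇒ small class number, with Louboutin's printed `log²`**: for `K` with `[K : ℚ] = 2`,
`d_K < −4`, if `ζ_K(β) = 0` (`dedekindZetaCont K`) for a real `0 < β < 1`, then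
**`h_K ≤ (1 − β) · π⁻¹ √|d_K| log²|d_K|/8`** — Louboutin 2006 Theorem 1 (ii) (3), odd case, AS PRINTED
(`0 < L(1, χ) ≤ (1 − β) log² f/8`, the sequel's `norm_LFunction_one_le_of_zero_of_odd_sharp`), read through
`ζ_K = ζ · L(·, κ)`, `ζ(β) < 0` on `(0, 1)` and the class number formula `L(1, κ) = π h_K/√|d_K|` (`w_K = 2`);
sharpens `classNumber_le_of_dedekindZetaCont_eq_zero` (`(log|d_K| + ½)²`). Same proof.
[cite: Louboutin2006RelativeClassNumbers, Thm 1 (3) p. 200] [cite: NeukirchANT1999, Ch. VII §5 (5.11)] -/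
theorem classNumber_le_of_dedekindZetaCont_eq_zero_sharp (h2 : Module.finrank ℚ K = 2)
    (hd : NumberField.discr K < -4) {β : ℝ} (hβ0 : 0 < β) (hβ1 : β < 1)
    (hz : dedekindZetaCont K β = 0) :
    (NumberField.classNumber K : ℝ) ≤
      (1 - β) * (Real.pi⁻¹ * Real.sqrt ((NumberField.discr K).natAbs : ℝ) *
        Real.log ((NumberField.discr K).natAbs : ℝ) ^ 2 / 8) := by
  classical
  have hneg : NumberField.discr K < 0 := by omega
  obtain ⟨M, _, κ, hM, hκ, hprim, hodd, hquad, hfac⟩ := exists_odd_quadratic_kroneckerChar h2 hneg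
  -- `ζ_K(β) = ζ(β) L(β, κ)` and `ζ(β) ≠ 0`
  have hβne : (β : ℂ) ≠ 1 := by
    intro h
    have := congrArg Complex.re h
    simp at this
    linarith
  have hfacβ := dedekindZetaCont_eq_riemannZeta_mul_LFunction (K := K) hκ hfac hβne
  rw [hz] at hfacβ
  have hζ : riemannZeta β ≠ 0 := (riemannZeta_neg_of_pos_of_lt_one hβ0 hβ1).ne
  have hLβ : κ.LFunction β = 0 := by
    rcases mul_eq_zero.mp hfacβ.symm with h | h
    · exact absurd h hζ
    · exact h
  have hB := norm_LFunction_one_le_of_zero_of_odd_sharp hprim hodd hquad hβ0 hβ1 hLβ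
  -- class number formula
  have hcnf := LFunction_one_eq_of_discr_neg_of_eq h2 hneg hκ (fun s hs ↦ hfac s (by simpa using hs))
  have hw : (NumberField.Units.torsionOrder K : ℝ) = 2 := by
    exact_mod_cast torsionOrder_eq_two_of_discr_lt_neg_four h2 hd
  have habs : |(NumberField.discr K : ℝ)| = (M : ℝ) := by
    rw [← Int.cast_abs, Int.abs_eq_natAbs, Int.cast_natCast, hM]
  have hM4 : (4 : ℝ) < M := by
    rw [← habs]
    have : (NumberField.discr K : ℝ) < -4 := by exact_mod_cast hd
    rw [abs_of_neg (by linarith)]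
    linarith
  rw [hcnf, Complex.norm_real, Real.norm_eq_abs, hw, habs, abs_of_nonneg (by positivity)] at hB
  have hsq : 0 < Real.sqrt (M : ℝ) := Real.sqrt_pos.2 (by linarith)
  have hπ := Real.pi_pos
  rw [div_le_iff₀ (by positivity)] at hB
  rw [← hM]
  set B : ℝ := (1 - β) * Real.log M ^ 2 / 8 with hBdef
  have hB' : 2 * Real.pi * NumberField.classNumber K ≤ B * (2 * Real.sqrt M) := hB
  calc (NumberField.classNumber K : ℝ)
      = Real.pi⁻¹ * (2 * Real.pi * NumberField.classNumber K) / 2 := by field_simp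
    _ ≤ Real.pi⁻¹ * (B * (2 * Real.sqrt M)) / 2 := by gcongr
    _ = (1 - β) * (Real.pi⁻¹ * Real.sqrt M * Real.log M ^ 2 / 8) := by rw [hBdef]; ring

/-- **I.1 kernel line, UPPER half, v5 (Louboutin's printed `log²`)**: for an imaginary quadratic field `K`
with odd `d_K < −4`, `q = |d_K|`, and a real zero `0 < β < 1` of `L(s, χ_{d_K})` (`χ_{d_K}` = the Jacobi
character mod `q`): **`h_K ≤ (1/(8π)) √q log² q (1 − β)`** — Louboutin 2006 Theorem 1 (ii), odd case, AS
PRINTED (`norm_LFunction_one_le_of_zero_of_odd_sharp`) through the class number formula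
`L(1, χ_{d_K}) = 2π h_K/(w_K √q)`, `w_K = 2`; sharpens v4 (`(log q + ½)²`).
[cite: Louboutin2006RelativeClassNumbers, Thm 1 (3) p. 200] [cite: NeukirchANT1999, Ch. VII §5 (5.11)] -/
theorem classNumber_le_of_realZero_explicit_v5 (h2 : Module.finrank ℚ K = 2)
    (hodd : Odd (NumberField.discr K)) (hd : NumberField.discr K < -4) {β : ℝ} (hβ0 : 0 < β) (hβ1 : β < 1)
    (hz : (jacobiChar (NumberField.discr K).natAbs).LFunction β = 0) :
    (NumberField.classNumber K : ℝ) ≤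
      1 / (8 * Real.pi) * Real.sqrt (NumberField.discr K).natAbs *
        Real.log (NumberField.discr K).natAbs ^ 2 * (1 - β) := by
  have hneg : NumberField.discr K < 0 := by omega
  haveI : NeZero (NumberField.discr K).natAbs := ⟨by omega⟩
  obtain ⟨hprim, hoddχ⟩ := jacobiChar_primitive_odd h2 hodd hneg
  have hB := norm_LFunction_one_le_of_zero_of_odd_sharp hprim hoddχ isQuadratic_jacobiChar hβ0 hβ1 hz
  have hcnf := LFunction_jacobiChar_one_eq_of_discr_neg h2 hodd hneg
  have habs : |(NumberField.discr K : ℝ)| = ((NumberField.discr K).natAbs : ℝ) := by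
    rw [← Int.cast_abs, Int.abs_eq_natAbs, Int.cast_natCast]
  have hw : (NumberField.Units.torsionOrder K : ℝ) = 2 := by
    exact_mod_cast torsionOrder_eq_two_of_discr_lt_neg_four h2 hd
  have hq4 : (4 : ℝ) < (NumberField.discr K).natAbs := by
    have : (4 : ℤ) < ((NumberField.discr K).natAbs : ℤ) := by omega
    exact_mod_cast this
  rw [hcnf, habs, hw, Complex.norm_real, Real.norm_eq_abs, abs_of_nonneg (by positivity)] at hB
  have hsq : 0 < Real.sqrt ((NumberField.discr K).natAbs : ℝ) := Real.sqrt_pos.2 (by linarith)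
  have hπ := Real.pi_pos
  rw [div_le_iff₀ (by positivity)] at hB
  set M : ℕ := (NumberField.discr K).natAbs
  set B : ℝ := (1 - β) * Real.log M ^ 2 / 8 with hBdef
  have hB' : 2 * Real.pi * NumberField.classNumber K ≤ B * (2 * Real.sqrt M) := hB
  calc (NumberField.classNumber K : ℝ)
      = Real.pi⁻¹ * (2 * Real.pi * NumberField.classNumber K) / 2 := by field_simp
    _ ≤ Real.pi⁻¹ * (B * (2 * Real.sqrt M)) / 2 := by gcongr
    _ = 1 / (8 * Real.pi) * Real.sqrt M * Real.log M ^ 2 * (1 - β) := by rw [hBdef]; field_simp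

/-- **I.1 kernel line, two-sided, v5**: for an imaginary quadratic `K`, odd `d_K`, `q = |d_K| ≥ 10⁴`, and a
real zero `β ≥ 1 − 1/(10 log q)` of `L(s, χ_{d_K})`:
**`(0.81/π) √q (1 − β) ≤ h_K ≤ (1/(8π)) √q log² q (1 − β)`** (lower half: the tree's
`classNumber_ge_of_realZero_explicit_v3`; upper half: v5 above, Louboutin's printed `log²`). Print comparator:
Benli–Goel–Twiss–Zaman 2025 Lemma 2.9 read through the class number formula
(`classNumber_bounds_of_landauSiegelZero`: `0.36/π · w_K √q (1−β₁) ≤ h_K ≤ 0.09/π · w_K √q log² q (1−β₁)`,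
`q > 4·10⁵`, MODULO the named fact `BGTZ2025.lemma29`); here `w_K = 2`, so the kernel upper constant
`1/(8π) = 0.125/π` against the print's `0.18/π`, hypothesis-free. [cite: BenliGoelTwissZaman2025, Lemma 2.9]
[cite: Louboutin2006RelativeClassNumbers, Thm 1 (3) p. 200] -/
theorem classNumber_two_sided_of_realZero_explicit_v5 (h2 : Module.finrank ℚ K = 2)
    (hodd : Odd (NumberField.discr K)) (hd : NumberField.discr K < 0)
    (hq : 10 ^ 4 ≤ (NumberField.discr K).natAbs) {β : ℝ}
    (hβ : 1 - 1 / (10 * Real.log (NumberField.discr K).natAbs) ≤ β)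
    (hz : (jacobiChar (NumberField.discr K).natAbs).LFunction β = 0) :
    0.81 / Real.pi * Real.sqrt (NumberField.discr K).natAbs * (1 - β) ≤ (NumberField.classNumber K : ℝ) ∧
      (NumberField.classNumber K : ℝ) ≤
        1 / (8 * Real.pi) * Real.sqrt (NumberField.discr K).natAbs *
          Real.log (NumberField.discr K).natAbs ^ 2 * (1 - β) := by
  haveI : NeZero (NumberField.discr K).natAbs := ⟨by omega⟩
  have hd4 : NumberField.discr K < -4 := by
    have : (10 ^ 4 : ℤ) ≤ ((NumberField.discr K).natAbs : ℤ) := by exact_mod_cast hq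
    omega
  have hne : jacobiChar (NumberField.discr K).natAbs ≠ 1 := jacobiChar_natAbs_discr_ne_one h2 hodd
  have hβ1 : β < 1 := RealZeroRepulsion.realZero_lt_one _ hne hz
  have hq' : (10 ^ 4 : ℝ) ≤ (NumberField.discr K).natAbs := by exact_mod_cast hq
  have hlog : 9 ≤ Real.log (NumberField.discr K).natAbs := by
    rw [Real.le_log_iff_exp_le (by linarith)]
    have h3 : Real.exp 9 = Real.exp 1 ^ 9 := by rw [← Real.exp_nat_mul]; norm_num
    have he : Real.exp 1 < 2.7182818286 := Real.exp_one_lt_d9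
    have h9 : Real.exp 1 ^ 9 < (2.7182818286 : ℝ) ^ 9 :=
      pow_lt_pow_left₀ he (Real.exp_pos 1).le (by norm_num)
    rw [h3]; nlinarith
  have hβ0 : 0 < β := by
    have : 1 / (10 * Real.log (NumberField.discr K).natAbs) ≤ 1 / 90 := by
      apply one_div_le_one_div_of_le (by norm_num); linarith
    linarith
  exact ⟨classNumber_ge_of_realZero_explicit_v3 h2 hodd hd hq hβ hz,
    classNumber_le_of_realZero_explicit_v5 h2 hodd hd4 hβ0 hβ1 hz⟩

end Louboutin2001

end Literature.NumberTheory.LFunctions
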